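import Literature.NumberTheory.QuadraticFields.BinaryQuadraticFormsClassNumber
import Literature.Barriers.Parity.SiegelZeroDichotomy
import HarnessLib

/-!
# A Siegel zero for `χ_{−D}` makes every primitive positive-definite binary quadratic form of
# discriminant `−D` represent a prime `p ≪_δ D^{6+δ}` (Zaman 2016, Corollary 1.2, principal case)

Statement layer for the «illusory world» column (conditional consequences of exceptional zeros),
topic «primes represented by binary quadratic forms / prime values of quadratic polynomials».
Source: A. Zaman, *On the least prime ideal and Siegel zeros*, Int. J. Number Theory 12 (2016)
2201–2229 = arXiv:1506.01635 (held, tex) [Zaman2016LeastPrimeIdealSiegel], §1: (1.4) (the real zero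
`β`), Theorem 1.1, Corollary 1.2 and the Remarks after each, Theorem 1.3.

## What the source prints (§1)

"For the remainder of the paper, suppose `ψ (mod 𝔮)` is a real Hecke character with a real zero
(1.4) `β = 1 − 1/(η log(n_K^{n_K} d_K N𝔮))` where `η ≥ 20`; that is, `β` is an exceptional zero of the
exceptional character `ψ`. If `1/η = o(1)` then we shall call `β` a Siegel zero."
**Theorem 1.1** (number field `K`, integral ideal `𝔮`, real Hecke character `ψ (mod 𝔮)` with a real
zero `β` as in (1.4), ray class `𝒞` with `ψ(𝒞) = 1`, `δ > 0`): there is a prime ideal `𝔭 ∈ 𝒞` with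
`N𝔭 ≪_δ {n_K^{A n_K} d_K^B (N𝔮)^C h(𝔮)²}^{1+δ} e^{O_δ(n_K)}` provided `η ≥ η(δ)`, with
`(A, B, C) = (16, 6 + 5/n_K, 5 + 2/n_K)` if `ψ` is quadratic and `(6, 3 + 4/n_K, 3)` if `ψ` is
principal; "All implicit constants are effective." Remark (K = ℚ, 𝔮 = (q)): "there exists a prime
`p ≡ a (mod q)` such that `p ≪_δ q^{9+δ}` provided `η ≥ η(δ)`" in the classes `ψ(a) = 1`.
"If `K` is an imaginary quadratic field of discriminant `D` then the ray class group `Cl(𝒪)` has a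
well-known correspondence with the group of form classes of primitive positive-definite integral
binary quadratic forms of discriminant `D`. Under this bijection, such a form `Q(x, y)` represents an
integer `m` if and only if its corresponding ray class `𝒞 ∈ Cl(𝒪)` contains an integral ideal `𝔪`
satisfying `N𝔪 = m`."
**Corollary 1.2.** "Let `K` be the imaginary quadratic field of discriminant `D ≥ 1`. Suppose
`ψ (mod 𝒪)` is a real Hecke character such that `L(s, ψ)` has a real zero `β` as in (1.4). Let
`δ > 0` and `Q(x, y)` be a primitive integral positive-definite binary quadratic form of discriminant
`D` in natural correspondence with a ray class `𝒞 ∈ Cl(𝒪)` satisfying `ψ(𝒞) = 1`. Then there exists a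
rational prime `p` such that `p = Q(x, y)` has a solution `(x, y) ∈ ℤ²` and `p ≪_δ D^{9.5+δ}` if `ψ` is
quadratic, `p ≪_δ D^{6+δ}` if `ψ` is principal, provided `η ≥ η(δ)`. All implicit constants are
effective." Remarks: with the (ineffective) Brauer–Siegel theorem `D^{7+δ}` / `D^{4+δ}`; "As far as
the author is aware, [Corollary 1.2] is the first result to bound the least prime represented by
quadratic forms with an explicit exponent uniformly over all discriminants, albeit conditionally in
an exceptional case."

## What is typed, and the dictionary used

Only the case **`ψ` PRINCIPAL** of Corollary 1.2 is typed — the case whose hypothesis is a Siegel zero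
of a DIRICHLET `L`-function and whose conclusion concerns EVERY form:

* `K = ℚ(√−D)` with `|d_K| = D` (the source's "discriminant `D ≥ 1`" is the absolute discriminant, as
  in its (1.4)): `n_K = 2`, `n_K^{n_K} d_K N𝒪 = 4D`, so (1.4) reads `β = 1 − 1/(η log 4D)`, `η ≥ 20`;
* for the principal character `ψ₀` of `Cl(𝒪)`, `L(s, ψ₀) = ζ_K(s) = ζ(s) L(s, χ_{−D})` with `χ_{−D}`
  the odd primitive quadratic Dirichlet character mod `D` (`−D` fundamental; tree dictionary
  `Literature.NumberTheory.LFunctions.PrimitiveQuadratic.apply_natCast_eq_jacobiSym_neg_of_odd`,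
  Montgomery–Vaughan §9.3). The typed hypothesis is `L(β, χ_{−D}) = 0`, which IMPLIES the printed one
  (`ζ_K(β) = ζ(β) L(β, χ_{−D}) = 0`); so the typed statement follows from the printed corollary;
* `ψ₀(𝒞) = 1` for every class `𝒞`, and the form classes of primitive positive-definite forms of
  discriminant `d_K = −D` are in bijection with `Cl(𝒪)` (the correspondence the source invokes,
  [Cox2013, Theorem 7.7]); hence the conclusion applies to EVERY primitive positive-definite integral
  form of discriminant `−D` — the tree's `BinQF.IsPosPrim (−D) f`
  (`Literature/NumberTheory/QuadraticFields/BinaryQuadraticFormsClassNumber.lean`), "`p = Q(x, y)` has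
  a solution" being `∃ x y, f.eval x y = p`;
* "`p ≪_δ D^{6+δ}` provided `η ≥ η(δ)`, implicit constants effective" is `∀ δ > 0, ∃ η₀ C, …,
  p ≤ C · D^{6+δ}` (effectivity of `η₀, C` is not expressible and is recorded here only).

`-- TODO(general form): the case ψ quadratic (a genus character of Cl(𝒪): forms in the classes with`
`-- ψ(𝒞) = 1, exponent 9.5 + δ) and Theorem 1.1 for a general number field need the ray-class /`
`-- class-group L-function layer (Literature.NumberTheory.LFunctions.NumberField.classGroupLFunction₀)`
`-- together with a typed form-class ↔ ideal-class correspondence, which the tree does not yet hold.`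

## Contents

* `zaman2016_corollary12_principal` — NAMED FACT, Corollary 1.2 (ψ principal) AS PRINTED modulo the
  dictionary above;
* PROVED reading on the column's predicate: `Zaman2016.exists_prime_repr_of_isSiegelZero` — modulo
  the fact, for every `δ > 0` there are `η₁, C` such that a Tao–Teräväinen Siegel zero of quality
  `η ≥ η₁` attached to an ODD character `χ` mod `D` (`L(1 − 1/(η log D), χ) = 0`) makes every
  primitive positive-definite form of discriminant `−D` represent a prime `p ≤ C D^{6+δ}` (the quality
  relative to `log 4D` is `η log D/log 4D ≥ η/3` for `D ≥ 2`).

LABEL: instrument / statement layer. WHAT THIS IS NOT: no claim that a Siegel zero exists;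
unconditionally the least prime represented by a form of discriminant `−D` is `≪ D^{L'}` with a much
larger (Chebotarev–Linnik) exponent, and `≪_δ D^{20/3+δ}` / `D^{3+δ}` only ON AVERAGE (Ditchen, quoted
in the source); nothing here bears on parity.

## References

* [Zaman2016LeastPrimeIdealSiegel] A. Zaman, *On the least prime ideal and Siegel zeros*, Int. J.
  Number Theory 12 (2016), no. 8, 2201–2229, doi:10.1142/S1793042116501335 = arXiv:1506.01635: §1
  (1.4), Theorem 1.1 and Remarks, Corollary 1.2 and Remarks, Theorem 1.3.
* [Cox2013] D. A. Cox, *Primes of the form x² + ny²*, 2nd ed., Wiley 2013: §2.A (forms), §7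
  Theorem 7.7 (form classes ↔ ideal classes).
* [TaoTeravainen2021] T. Tao, J. Teräväinen, J. London Math. Soc. 106 (2022), Definition 1.4.
-/

noncomputable section

open Real
open Literature.Barriers.Parity
open Literature.NumberTheory.QuadraticFields.Quadratic

namespace Literature.NumberTheory.LFunctions

namespace Zaman2016

/-- Zaman's normalisation (1.4) of the real zero for `K = ℚ(√−D)`, `𝔮 = 𝒪`:
`β = 1 − 1/(η log(n_K^{n_K} d_K N𝔮)) = 1 − 1/(η log 4D)`. [cite: Zaman2016LeastPrimeIdealSiegel, §1 (1.4)] -/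
def realZero (D : ℕ) (η : ℝ) : ℝ := 1 - 1 / (η * Real.log (4 * D))

end Zaman2016

/-- **Zaman 2016, Corollary 1.2, case `ψ` principal** (NAMED FACT, AS PRINTED modulo the dictionary of
the module docstring): for every `δ > 0` there are `η₀` ("`η ≥ η(δ)`") and `C` ("`≪_δ`", effective)
such that: if `−D` is a negative fundamental discriminant — `χ` the odd primitive quadratic character
mod `D` — and `L(s, χ)` (hence `ζ_{ℚ(√−D)} = ζ · L(s, χ) = L(s, ψ₀)`) has the real zero
`β = 1 − 1/(η log 4D)` with `η ≥ 20` and `η ≥ η₀`, then EVERY primitive positive-definite integral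
binary quadratic form `Q` of discriminant `−D` (every class `𝒞` has `ψ₀(𝒞) = 1`) represents a rational
prime `p = Q(x, y)` with `p ≤ C · D^{6+δ}`. Not proved here (Theorem 1.3 of the source: a
zero-dimensional sieve lower bound for prime ideals in a ray class under the exceptional zero).
[cite: Zaman2016LeastPrimeIdealSiegel, §1 Corollary 1.2 (ψ principal) with (1.4) and the form–class correspondence]
[cite: Cox2013, Theorem 7.7] -/
def zaman2016_corollary12_principal : Prop :=
  ∀ δ : ℝ, 0 < δ → ∃ (η₀ C : ℝ), 0 < C ∧
    ∀ (D : ℕ) [NeZero D] (χ : DirichletCharacter ℂ D) (η : ℝ) (f : BinQF),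
      χ.IsPrimitive → χ.IsQuadratic → χ.Odd → 20 ≤ η → η₀ ≤ η →
      χ.LFunction ((Zaman2016.realZero D η : ℝ) : ℂ) = 0 →
      f.IsPosPrim (-(D : ℤ)) →
        ∃ (p : ℕ) (x y : ℤ), p.Prime ∧ f.eval x y = (p : ℤ) ∧ (p : ℝ) ≤ C * (D : ℝ) ^ (6 + δ)

namespace Zaman2016

/-- `log 4D ≤ 3 log D` for `D ≥ 2`. [folklore] -/
private theorem log_four_mul_le {D : ℝ} (hD : 2 ≤ D) : Real.log (4 * D) ≤ 3 * Real.log D := by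
  have hD0 : 0 < D := by linarith
  rw [Real.log_mul (by norm_num) hD0.ne']
  have h4 : Real.log 4 = 2 * Real.log 2 := by
    rw [show (4 : ℝ) = 2 ^ 2 by norm_num, Real.log_pow]; norm_num
  have h2 : Real.log 2 ≤ Real.log D := Real.log_le_log (by norm_num) hD
  linarith

/-- **The least prime represented by binary quadratic forms in the illusory world** (PROVED modulo
`zaman2016_corollary12_principal`): for every `δ > 0` there are `η₁` and `C > 0` such that for every
`D ≥ 2`, every ODD character `χ` mod `D` carrying a Tao–Teräväinen Siegel zero of quality `η ≥ η₁`
(`χ` primitive quadratic, `L(1 − 1/(η log D), χ) = 0`), and every primitive positive-definite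
integral form `f` of discriminant `−D`, some prime `p ≤ C · D^{6+δ}` is represented by `f`. The
Tao–Teräväinen zero `1 − 1/(η log D)` is Zaman's `1 − 1/(η' log 4D)` with
`η' = η log D / log 4D ≥ η/3`, so `η₁ = 3 max(20, η₀)` works.
[cite: Zaman2016LeastPrimeIdealSiegel, §1 Corollary 1.2 (ψ principal)] [cite: TaoTeravainen2021, Definition 1.4] -/
theorem exists_prime_repr_of_isSiegelZero (h : zaman2016_corollary12_principal) {δ : ℝ}
    (hδ : 0 < δ) :
    ∃ (η₁ C : ℝ), 0 < C ∧ ∀ (D : ℕ) [NeZero D] (χ : DirichletCharacter ℂ D) (η : ℝ) (f : BinQF),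
      2 ≤ D → IsSiegelZero χ η → χ.Odd → η₁ ≤ η → f.IsPosPrim (-(D : ℤ)) →
        ∃ (p : ℕ) (x y : ℤ), p.Prime ∧ f.eval x y = (p : ℤ) ∧ (p : ℝ) ≤ C * (D : ℝ) ^ (6 + δ) := by
  obtain ⟨η₀, C, hC, hmain⟩ := h δ hδ
  refine ⟨3 * max 20 η₀, C, hC, fun D _ χ η f hD hSZ hodd hη hf => ?_⟩
  obtain ⟨hprim, hquad, h10, hzero⟩ := hSZ
  have hD2 : (2 : ℝ) ≤ D := by exact_mod_cast hD
  have hD0 : (0 : ℝ) < D := by linarith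
  have hlogD : 0 < Real.log D := Real.log_pos (by linarith)
  have hlog4D : 0 < Real.log (4 * D) := Real.log_pos (by linarith)
  have hη0 : 0 < η := by linarith
  have hmax : max 20 η₀ ≤ η / 3 := by linarith
  -- Zaman's quality `η' = η log D / log 4D`
  set η' : ℝ := η * Real.log D / Real.log (4 * D) with hη'def
  have hη'ge : η / 3 ≤ η' := by
    rw [hη'def, le_div_iff₀ hlog4D]
    have := log_four_mul_le hD2
    nlinarith
  have h20 : 20 ≤ η' := le_trans (le_trans (le_max_left _ _) hmax) hη'ge
  have hη₀ : η₀ ≤ η' := le_trans (le_trans (le_max_right _ _) hmax) hη'ge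
  -- the two normalisations give the same zero
  have hsame : Zaman2016.realZero D η' = 1 - 1 / (η * Real.log D) := by
    rw [Zaman2016.realZero, hη'def]
    field_simp
  have hzero' : χ.LFunction ((Zaman2016.realZero D η' : ℝ) : ℂ) = 0 := by
    rw [hsame]; exact hzero
  exact hmain D χ η' f hprim hquad hodd h20 hη₀ hzero' hf

end Zaman2016

end Literature.NumberTheory.LFunctions

end
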